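import Mathlib.Analysis.Calculus.DerivativeTest
import Literature.Analysis.FluidPDE.TwoPointMaximumPrinciple
import Literature.Analysis.FluidPDE.HalfLineOUBarrier
import HarnessLib

/-!
# Half-line Ornstein–Uhlenbeck comparison in the cubic growth class (`HalfLineOUDecay`)

Topic `Literature/Analysis/FluidPDE` (family `ns`).  The one-dimensional parabolic comparison
(Phragmén–Lindelöf form of the weak maximum principle, [Lieberman1996, Ch. II Lemma 2.1/2.3] with a
barrier) behind the net-flux line on crux `PoloidalLiouville` (stmt-NavierStokesRegularity-1222, W1;
`Cruxes/PoloidalLiouville/NetFluxTransportSketch.lean`, Prop `NetFlux.HalfLineOUDecay`, ns-idea-14): a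
continuous `U ≥ 0` on `[s₁,∞) × [0,∞)`, `C²` in `ρ > 0`, differentiable in `s > s₁`, with `U(s,0) = 0`,
`U ≤ c(1+ρ)³` and `∂ₛU ≤ U_ρρ + (C − ρ/2)U_ρ` decays: `U(s,ρ) ≤ A·c·(1+ρ)³·e^{−λ(s−s₁)}` with `λ > 0`, `A`
depending on `C ≥ 0` only (`HalfLineOU.halfLineOU_decay`, the statement VERBATIM).
Proof: the tree's abstract weak maximum principle `TwoPoint.weak_max_principle_localMax` on
`[s₁,s] × [0,R]` applied to `U − Φ − cηZ`, where `Φ = A₀ c e^{−λ(s−s₁)} K(ρ)` with the cubic-growth barrier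
`K` of `HalfLineOU.exists_cubic_barrier` (`(1+ρ)³ ≤ A₀K ≤ A₀A₁(1+ρ)³`), and `Z = e^{(12+4C)(s−s₁)}(1+ρ⁴)`
is a supersolution that dominates `c(1+R)³` on the far boundary; `R → ∞`, `η → 0`.
WHAT THIS IS NOT: a statement about one linear 1-D inequality; nothing here proves or refutes
`stub_scalarLiouville`, `PoloidalLiouville` or Navier–Stokes regularity.
-/

noncomputable section

open Set Function Filter Topology MeasureTheory
open scoped Topology

namespace Literature.Analysis.FluidPDE

namespace HalfLineOU

/-! ### §1 Second-order condition at a local maximum -/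

/-- At a local maximum of a function continuous there, `deriv (deriv g) ≤ 0` (contrapositive of
Mathlib's second-derivative test `isLocalMin_of_deriv_deriv_pos`: a point that is both a local max and a
local min is a point of local constancy, where `deriv (deriv g) = 0`). [folklore] -/
private theorem deriv_deriv_nonpos_of_isLocalMax {g : ℝ → ℝ} {x : ℝ} (hmax : IsLocalMax g x)
    (hc : ContinuousAt g x) : deriv (deriv g) x ≤ 0 := by
  by_contra h
  push Not at h
  have hmin : IsLocalMin g x := isLocalMin_of_deriv_deriv_pos h hmax.deriv_eq_zero hc
  have hconst : ∀ᶠ y in 𝓝 x, g y = g x := by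
    filter_upwards [hmax, hmin] with y h1 h2
    exact le_antisymm h1 h2
  have hd : ∀ᶠ y in 𝓝 x, deriv g y = 0 := by
    filter_upwards [hconst.eventually_nhds] with y hy
    have : deriv g y = deriv (fun _ => g x) y := Filter.EventuallyEq.deriv_eq hy
    simpa using this
  have h0 : deriv (deriv g) x = deriv (fun _ => (0 : ℝ)) x := Filter.EventuallyEq.deriv_eq hd
  simp at h0
  exact absurd h0 (ne_of_gt h)

/-! ### §3 The comparison theorem -/

/-- **Half-line OU decay in the cubic growth class** — verbatim the Prop `NetFlux.HalfLineOUDecay` of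
`Cruxes/PoloidalLiouville/NetFluxTransportSketch.lean` (ns-idea-14): for every `C ≥ 0` there are
`λ > 0` and `A` such that every continuous `U` on `[s₁,∞) × [0,∞)`, `C²` in `ρ` on `(0,∞)` for `s > s₁`,
differentiable in `s` on `(s₁,∞)` for `ρ > 0`, with `U(s,0) = 0`, `0 ≤ U ≤ c(1+ρ)³` and
`∂ₛU ≤ U_ρρ + (C − ρ/2)U_ρ` (`s > s₁`, `ρ > 0`) satisfies `U(s,ρ) ≤ A·c·(1+ρ)³·e^{−λ(s−s₁)}`.
Weak maximum principle with the cubic barrier of `exists_cubic_barrier` and the auxiliary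
supersolution `e^{(12+4C)(s−s₁)}(1+ρ⁴)` (Phragmén–Lindelöf on `[0,R]`, `R → ∞`).
[cite: Lieberman1996, Ch. II Lemma 2.1 and Lemma 2.3 (weak maximum principle with a comparison function)] -/
theorem halfLineOU_decay : ∀ C : ℝ, 0 ≤ C → ∃ lam > 0, ∃ A : ℝ, ∀ (U : ℝ → ℝ → ℝ) (s₁ c : ℝ),
    ContinuousOn (uncurry U) (Ici s₁ ×ˢ Ici 0) →
    (∀ s, s₁ < s → ContDiffOn ℝ 2 (U s) (Ioi 0)) →
    (∀ ρ, 0 < ρ → DifferentiableOn ℝ (fun s => U s ρ) (Ioi s₁)) →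
    (∀ s, s₁ ≤ s → U s 0 = 0) →
    (∀ s, s₁ ≤ s → ∀ ρ, 0 ≤ ρ → 0 ≤ U s ρ ∧ U s ρ ≤ c * (1 + ρ) ^ 3) →
    (∀ s, s₁ < s → ∀ ρ, 0 < ρ →
        deriv (fun σ => U σ ρ) s ≤ iteratedDeriv 2 (U s) ρ + (C - ρ / 2) * deriv (U s) ρ) →
    ∀ s, s₁ ≤ s → ∀ ρ, 0 ≤ ρ → U s ρ ≤ A * c * (1 + ρ) ^ 3 * Real.exp (-lam * (s - s₁)) := by
  intro C hC
  obtain ⟨K, K', K'', lam, ε, kM, hlam, hε, hkM, hK1, hK2, hKin, hKone, hKcub, hKup⟩ :=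
    exists_cubic_barrier hC
  set A₀ : ℝ := 8 + 8 / ε with hA₀
  set A₁ : ℝ := kM + ε with hA₁
  have hA₀0 : 0 < A₀ := by rw [hA₀]; positivity
  have hA₁0 : 0 < A₁ := by rw [hA₁]; positivity
  -- `(1+r)³ ≤ A₀ K r` and `K r ≤ A₁ (1+r)³`
  have h8A : (8 : ℝ) ≤ A₀ := by
    rw [hA₀]; have := div_pos (by norm_num : (0:ℝ) < 8) hε; linarith
  have hlow : ∀ r, 0 ≤ r → (1 + r) ^ 3 ≤ A₀ * K r := by
    intro r hr
    have h1 := hKone r hr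
    have h2 := hKcub r hr
    rcases le_or_gt r 1 with hr1 | hr1
    · have h3 : (1 + r) ^ 3 ≤ (2 : ℝ) ^ 3 := pow_le_pow_left₀ (by linarith) (by linarith) 3
      have h4 : (8 : ℝ) * 1 ≤ A₀ * K r := mul_le_mul h8A h1 zero_le_one hA₀0.le
      norm_num at h3
      linarith
    · have h3 : (1 + r) ^ 3 ≤ (2 * r) ^ 3 := pow_le_pow_left₀ (by linarith) (by linarith) 3
      have h3' : (2 * r) ^ 3 = 8 * r ^ 3 := by ring
      have h4 : 8 * r ^ 3 = (8 / ε) * (ε * r ^ 3) := by field_simp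
      have h5 : (8 / ε) * (ε * r ^ 3) ≤ (8 / ε) * K r :=
        mul_le_mul_of_nonneg_left h2 (by positivity)
      have h6 : (8 / ε) * K r ≤ A₀ * K r := by
        apply mul_le_mul_of_nonneg_right _ (by linarith)
        rw [hA₀]; linarith
      linarith
  have hup : ∀ r, 0 ≤ r → K r ≤ A₁ * (1 + r) ^ 3 := by
    intro r hr
    have h1 := hKup r hr
    have h2 : (1 : ℝ) ^ 3 ≤ (1 + r) ^ 3 := pow_le_pow_left₀ zero_le_one (by linarith) 3
    have h3 : r ^ 3 ≤ (1 + r) ^ 3 := pow_le_pow_left₀ hr (by linarith) 3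
    rw [one_pow] at h2
    have h4 := mul_le_mul_of_nonneg_left h3 hε.le
    have h5 := mul_le_mul_of_nonneg_left h2 hkM
    rw [hA₁]; linarith
  refine ⟨lam, hlam, A₀ * A₁, ?_⟩
  intro U s₁ c hcont hC2 hdiff h0 hbd hsub s hs ρ hρ
  -- `c ≥ 0`
  have hc0 : 0 ≤ c := by
    have := (hbd s₁ le_rfl 0 le_rfl)
    nlinarith [this.1, this.2]
  set ν : ℝ := 12 + 4 * C with hν
  have hν0 : 0 ≤ ν := by rw [hν]; linarith
  -- the two comparison functions
  set Φ : ℝ → ℝ → ℝ := fun σ r => A₀ * c * Real.exp (-lam * (σ - s₁)) * K r with hΦ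
  set Z : ℝ → ℝ → ℝ := fun σ r => Real.exp (ν * (σ - s₁)) * (1 + r ^ 4) with hZ
  have hΦnn : ∀ σ r, 0 ≤ r → 0 ≤ Φ σ r := fun σ r hr => by
    rw [hΦ]; have := hKone r hr; positivity
  have hZnn : ∀ σ r, 0 ≤ Z σ r := fun σ r => by rw [hZ]; positivity
  -- MAIN CLAIM: `U s ρ ≤ Φ s ρ + c η Z s ρ` for every `η > 0`
  have key : ∀ η : ℝ, 0 < η → U s ρ ≤ Φ s ρ + c * η * Z s ρ := by
    intro η hη
    rcases eq_or_lt_of_le hs with hss | hss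
    · -- `s = s₁`
      rw [← hss]
      have h1 := (hbd s₁ le_rfl ρ hρ).2
      have h2 : c * (1 + ρ) ^ 3 ≤ Φ s₁ ρ := by
        show c * (1 + ρ) ^ 3 ≤ A₀ * c * Real.exp (-lam * (s₁ - s₁)) * K ρ
        rw [sub_self, mul_zero, Real.exp_zero, mul_one]
        have := mul_le_mul_of_nonneg_left (hlow ρ hρ) hc0
        linarith
      have h3 : 0 ≤ c * η * Z s₁ ρ := by have := hZnn s₁ ρ; positivity
      linarith
    -- `s > s₁`: maximum principle on `[s₁, s] × [0, R]`
    set R : ℝ := ρ + 1 + 8 / η with hR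
    have hR1 : 1 ≤ R := by rw [hR]; have := div_pos (by norm_num : (0:ℝ) < 8) hη; linarith
    have hρR : ρ < R := by rw [hR]; have := div_pos (by norm_num : (0:ℝ) < 8) hη; linarith
    have hRη : (1 + R) ^ 3 ≤ η * (1 + R ^ 4) := by
      have h1 : (1 + R) ^ 3 ≤ (2 * R) ^ 3 := pow_le_pow_left₀ (by linarith) (by linarith) 3
      have h1' : (2 * R) ^ 3 = 8 * R ^ 3 := by ring
      have h2 : 8 / η ≤ R := by rw [hR]; linarith
      have h3 : 8 ≤ η * R := by
        have := mul_le_mul_of_nonneg_left h2 hη.le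
        rwa [mul_div_cancel₀ _ hη.ne'] at this
      have hR3 : 0 ≤ R ^ 3 := by positivity
      have h4 : 8 * R ^ 3 ≤ η * R * R ^ 3 := mul_le_mul_of_nonneg_right h3 hR3
      have h5 : η * R * R ^ 3 = η * R ^ 4 := by ring
      have h6 : η * R ^ 4 ≤ η * (1 + R ^ 4) := by nlinarith [hη.le]
      linarith
    set w : ℝ → ℝ → ℝ := fun σ r => U σ r - Φ σ r - c * η * Z σ r with hw
    set wt : ℝ → ℝ → ℝ := fun σ r => deriv (fun τ => U τ r) σ
      - (-lam) * Φ σ r - c * η * (ν * Z σ r) with hwt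
    -- derivative facts for `Φ`, `Z`
    have hΦt : ∀ σ r, HasDerivAt (fun τ => Φ τ r) ((-lam) * Φ σ r) σ := by
      intro σ r
      have h1 : HasDerivAt (fun τ => -lam * (τ - s₁)) (-lam * 1) σ :=
        ((hasDerivAt_id' σ).sub_const s₁).const_mul (-lam)
      have h2 := ((h1.exp).const_mul (A₀ * c)).mul_const (K r)
      refine h2.congr_deriv ?_
      show A₀ * c * (Real.exp (-lam * (σ - s₁)) * (-lam * 1)) * K r
        = -lam * (A₀ * c * Real.exp (-lam * (σ - s₁)) * K r)
      ring
    have hZt : ∀ σ r, HasDerivAt (fun τ => Z τ r) (ν * Z σ r) σ := by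
      intro σ r
      have h1 : HasDerivAt (fun τ => ν * (τ - s₁)) (ν * 1) σ :=
        ((hasDerivAt_id' σ).sub_const s₁).const_mul ν
      have h2 := (h1.exp).mul_const (1 + r ^ 4)
      refine h2.congr_deriv ?_
      show Real.exp (ν * (σ - s₁)) * (ν * 1) * (1 + r ^ 4) = ν * (Real.exp (ν * (σ - s₁)) * (1 + r ^ 4))
      ring
    have hΦr : ∀ σ r, HasDerivAt (Φ σ) (A₀ * c * Real.exp (-lam * (σ - s₁)) * K' r) r :=
      fun σ r => (hK1 r).const_mul _
    have hΦrr : ∀ σ r, HasDerivAt (fun r => A₀ * c * Real.exp (-lam * (σ - s₁)) * K' r)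
        (A₀ * c * Real.exp (-lam * (σ - s₁)) * K'' r) r := fun σ r => (hK2 r).const_mul _
    have hZr : ∀ σ r, HasDerivAt (Z σ) (Real.exp (ν * (σ - s₁)) * (4 * r ^ 3)) r := by
      intro σ r
      have h0 : HasDerivAt (fun r : ℝ => r ^ 4) (4 * r ^ 3) r := by simpa using hasDerivAt_pow 4 r
      exact ((h0.const_add 1).const_mul (Real.exp (ν * (σ - s₁)))).congr_deriv (by ring)
    have hZrr : ∀ σ r, HasDerivAt (fun r => Real.exp (ν * (σ - s₁)) * (4 * r ^ 3))
        (Real.exp (ν * (σ - s₁)) * (12 * r ^ 2)) r := by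
      intro σ r
      have h0 : HasDerivAt (fun r : ℝ => r ^ 3) (3 * r ^ 2) r := by simpa using hasDerivAt_pow 3 r
      exact ((h0.const_mul 4).const_mul (Real.exp (ν * (σ - s₁)))).congr_deriv (by ring)
    -- continuity of `K`, `Φ`, `Z`
    have hKc : Continuous K := continuous_iff_continuousAt.2 fun r => (hK1 r).continuousAt
    have hΦc : Continuous (uncurry Φ) := by
      rw [hΦ]
      show Continuous fun p : ℝ × ℝ => A₀ * c * Real.exp (-lam * (p.1 - s₁)) * K p.2
      fun_prop
    have hZc : Continuous (uncurry Z) := by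
      rw [hZ]
      show Continuous fun p : ℝ × ℝ => Real.exp (ν * (p.1 - s₁)) * (1 + p.2 ^ 4)
      fun_prop
    ---------------------------------------------------------------- hypotheses of the weak maximum principle
    have hc' : ContinuousOn (uncurry w) (Icc s₁ s ×ˢ Icc 0 R) := by
      have hU : ContinuousOn (uncurry U) (Icc s₁ s ×ˢ Icc 0 R) :=
        hcont.mono (prod_mono Icc_subset_Ici_self Icc_subset_Ici_self)
      have h1 : ContinuousOn (fun p : ℝ × ℝ => uncurry U p - uncurry Φ p - c * η * uncurry Z p)
          (Icc s₁ s ×ˢ Icc 0 R) :=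
        (hU.sub hΦc.continuousOn).sub ((hZc.continuousOn).const_smul (c * η) |>.congr
          (fun p _ => by simp [smul_eq_mul]))
      exact h1.congr fun p _ => by rcases p with ⟨σ, r⟩; rfl
    have ht' : ∀ t ∈ Ioc s₁ s, ∀ x ∈ Ioo 0 R,
        HasDerivWithinAt (fun σ => w σ x) (wt t x) (Icc s₁ t) t := by
      intro t ht x hx
      have hUt : HasDerivAt (fun τ => U τ x) (deriv (fun τ => U τ x) t) t :=
        ((hdiff x hx.1).differentiableAt (Ioi_mem_nhds ht.1)).hasDerivAt
      have h := (hUt.sub (hΦt t x)).sub ((hZt t x).const_mul (c * η))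
      exact h.hasDerivWithinAt
    have hsub' : ∀ t ∈ Ioc s₁ s, ∀ x ∈ Ioo 0 R, IsLocalMax (w t) x → wt t x ≤ 0 := by
      intro t ht x hx hmax
      have hx0 : 0 < x := hx.1
      -- regularity of `U t` near `x`
      have hUC2 : ContDiffOn ℝ 2 (U t) (Ioi 0) := hC2 t ht.1
      have hUd : DifferentiableOn ℝ (U t) (Ioi 0) := hUC2.differentiableOn (by norm_num)
      have hUd1 : ContDiffOn ℝ 1 (deriv (U t)) (Ioi 0) :=
        hUC2.deriv_of_isOpen isOpen_Ioi (by norm_num)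
      have hU'd : DifferentiableAt ℝ (deriv (U t)) x :=
        (hUd1.differentiableOn (by norm_num)).differentiableAt (Ioi_mem_nhds hx0)
      have hUx : HasDerivAt (U t) (deriv (U t) x) x :=
        (hUd.differentiableAt (Ioi_mem_nhds hx0)).hasDerivAt
      -- first derivative of the slice `w t`
      have hw1 : ∀ y, 0 < y → HasDerivAt (w t)
          (deriv (U t) y - A₀ * c * Real.exp (-lam * (t - s₁)) * K' y
            - c * η * (Real.exp (ν * (t - s₁)) * (4 * y ^ 3))) y := by
        intro y hy
        have hUy : HasDerivAt (U t) (deriv (U t) y) y :=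
          (hUd.differentiableAt (Ioi_mem_nhds hy)).hasDerivAt
        exact (hUy.sub (hΦr t y)).sub ((hZr t y).const_mul (c * η))
      have hderiv1 : deriv (w t) x = deriv (U t) x - A₀ * c * Real.exp (-lam * (t - s₁)) * K' x
            - c * η * (Real.exp (ν * (t - s₁)) * (4 * x ^ 3)) := (hw1 x hx0).deriv
      have hzero : deriv (w t) x = 0 := hmax.deriv_eq_zero
      -- second derivative of the slice
      have hev : deriv (w t) =ᶠ[𝓝 x] fun y => deriv (U t) y
          - A₀ * c * Real.exp (-lam * (t - s₁)) * K' y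
          - c * η * (Real.exp (ν * (t - s₁)) * (4 * y ^ 3)) := by
        filter_upwards [Ioi_mem_nhds hx0] with y hy
        exact (hw1 y hy).deriv
      have hw2 : HasDerivAt (deriv (w t))
          (deriv (deriv (U t)) x - A₀ * c * Real.exp (-lam * (t - s₁)) * K'' x
            - c * η * (Real.exp (ν * (t - s₁)) * (12 * x ^ 2))) x := by
        have h1 := (hU'd.hasDerivAt.sub (hΦrr t x)).sub ((hZrr t x).const_mul (c * η))
        exact h1.congr_of_eventuallyEq hev
      have hderiv2 : deriv (deriv (w t)) x = deriv (deriv (U t)) x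
            - A₀ * c * Real.exp (-lam * (t - s₁)) * K'' x
            - c * η * (Real.exp (ν * (t - s₁)) * (12 * x ^ 2)) := hw2.deriv
      have hcont_wt : ContinuousAt (w t) x := (hw1 x hx0).continuousAt
      have hsecond : deriv (deriv (w t)) x ≤ 0 := deriv_deriv_nonpos_of_isLocalMax hmax hcont_wt
      -- the differential inequality for `U`
      have hUsub := hsub t ht.1 x hx0
      rw [iteratedDeriv_succ, iteratedDeriv_one] at hUsub
      -- barrier inequalities
      have hKx := hKin x hx0
      have hexp0 : 0 ≤ A₀ * c * Real.exp (-lam * (t - s₁)) := by positivity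
      have hZineq : 12 * x ^ 2 + (C - x / 2) * (4 * x ^ 3) ≤ ν * (1 + x ^ 4) := by
        rw [hν]
        have h1 : x ^ 2 ≤ 1 + x ^ 4 := by nlinarith only [sq_nonneg (x ^ 2 - 1), sq_nonneg x]
        have h4 : 0 ≤ x ^ 4 := pow_nonneg hx0.le 4
        have h2 : x ^ 3 ≤ 1 + x ^ 4 := by
          have hsos : 0 ≤ (x - 1) ^ 2 * (3 * x ^ 2 + 2 * x + 1) :=
            mul_nonneg (sq_nonneg _) (by positivity)
          linarith only [hsos, h4]
        have h5 := mul_le_mul_of_nonneg_left h2 (by linarith : (0:ℝ) ≤ 4 * C)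
        linarith only [h1, h5, h4]
      have hexpZ : 0 ≤ c * η * Real.exp (ν * (t - s₁)) := by positivity
      -- assemble: `wt ≤ w_rr + (C - x/2) w_r = deriv (deriv (w t)) x + (C - x/2) * 0 ≤ 0`
      show deriv (fun τ => U τ x) t - (-lam) * (A₀ * c * Real.exp (-lam * (t - s₁)) * K x)
        - c * η * (ν * (Real.exp (ν * (t - s₁)) * (1 + x ^ 4))) ≤ 0
      generalize hEx : A₀ * c * Real.exp (-lam * (t - s₁)) = Ex at *
      generalize hEz : Real.exp (ν * (t - s₁)) = Ez at *
      generalize ha : deriv (fun τ => U τ x) t = a at *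
      generalize hu1 : deriv (U t) x = u1 at *
      generalize hu2 : deriv (deriv (U t)) x = u2 at *
      have hu1v : u1 = Ex * K' x + c * η * (Ez * (4 * x ^ 3)) := by linarith [hderiv1, hzero]
      have hu2v : u2 ≤ Ex * K'' x + c * η * (Ez * (12 * x ^ 2)) := by linarith [hderiv2, hsecond]
      have hprod : (C - x / 2) * u1 = (C - x / 2) * (Ex * K' x + c * η * (Ez * (4 * x ^ 3))) := by
        rw [hu1v]
      have hbar : Ex * (K'' x + (C - x / 2) * K' x + lam * K x) ≤ Ex * 0 :=
        mul_le_mul_of_nonneg_left hKx hexp0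
      have hZf : c * η * Ez * (12 * x ^ 2 + (C - x / 2) * (4 * x ^ 3)) ≤ c * η * Ez * (ν * (1 + x ^ 4)) :=
        mul_le_mul_of_nonneg_left hZineq hexpZ
      linarith [hUsub, hu2v, hprod, hbar, hZf]
    have hbot' : ∀ x ∈ Icc 0 R, w s₁ x ≤ 0 := by
      intro x hx
      have h1 := (hbd s₁ le_rfl x hx.1).2
      have h2 : c * (1 + x) ^ 3 ≤ Φ s₁ x := by
        show c * (1 + x) ^ 3 ≤ A₀ * c * Real.exp (-lam * (s₁ - s₁)) * K x
        rw [sub_self, mul_zero, Real.exp_zero, mul_one]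
        nlinarith [mul_le_mul_of_nonneg_left (hlow x hx.1) hc0]
      have h3 : 0 ≤ c * η * Z s₁ x := by have := hZnn s₁ x; positivity
      show U s₁ x - Φ s₁ x - c * η * Z s₁ x ≤ 0
      linarith
    have hlat' : ∀ t ∈ Icc s₁ s, ∀ x ∈ Icc 0 R \ Ioo 0 R, w t x ≤ 0 := by
      intro t ht x hx
      have hxK := hx.1
      have hxU : x ∉ Ioo 0 R := hx.2
      have hx0R : x = 0 ∨ x = R := by
        rcases eq_or_lt_of_le hxK.1 with h | h
        · exact Or.inl h.symm
        · right
          by_contra hne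
          exact hxU ⟨h, lt_of_le_of_ne hxK.2 hne⟩
      show U t x - Φ t x - c * η * Z t x ≤ 0
      rcases hx0R with rfl | rfl
      · rw [h0 t ht.1]
        have := hΦnn t 0 le_rfl
        have := hZnn t 0
        have : 0 ≤ c * η * Z t 0 := by positivity
        linarith
      · have h1 := (hbd t ht.1 R (by linarith)).2
        have h2 : c * (1 + R) ^ 3 ≤ c * η * Z t R := by
          show c * (1 + R) ^ 3 ≤ c * η * (Real.exp (ν * (t - s₁)) * (1 + R ^ 4))
          have he : 1 ≤ Real.exp (ν * (t - s₁)) := by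
            apply Real.one_le_exp; exact mul_nonneg hν0 (by linarith [ht.1])
          have h3 : η * (1 + R ^ 4) ≤ η * (Real.exp (ν * (t - s₁)) * (1 + R ^ 4)) := by
            have : (1 + R ^ 4) ≤ Real.exp (ν * (t - s₁)) * (1 + R ^ 4) := by
              nlinarith [pow_nonneg (by linarith : (0:ℝ) ≤ R) 4]
            exact mul_le_mul_of_nonneg_left this hη.le
          nlinarith [mul_le_mul_of_nonneg_left (hRη.trans h3) hc0]
        have := hΦnn t R (by linarith)
        linarith
    have mp := TwoPoint.weak_max_principle_localMax (X := ℝ) isCompact_Icc isOpen_Ioo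
      Ioo_subset_Icc_self hc' ht' hsub' hbot' hlat'
    have := mp s ⟨hs, le_rfl⟩ ρ ⟨hρ, hρR.le⟩
    show U s ρ ≤ Φ s ρ + c * η * Z s ρ
    have hwdef : w s ρ = U s ρ - Φ s ρ - c * η * Z s ρ := rfl
    linarith
  -- let `η → 0`
  have hlim : U s ρ ≤ Φ s ρ := by
    apply le_of_forall_pos_le_add
    intro e he
    have hZ0 := hZnn s ρ
    set η : ℝ := e / (c * Z s ρ + 1) with hη
    have hden : 0 < c * Z s ρ + 1 := by positivity
    have hη0 : 0 < η := div_pos he hden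
    have h1 := key η hη0
    have h2 : c * η * Z s ρ ≤ e := by
      have : c * η * Z s ρ = e * (c * Z s ρ / (c * Z s ρ + 1)) := by rw [hη]; field_simp
      rw [this]
      have : c * Z s ρ / (c * Z s ρ + 1) ≤ 1 := by
        rw [div_le_one hden]; linarith
      nlinarith
    linarith
  -- `Φ s ρ ≤ A₀ A₁ c (1+ρ)³ e^{−λ(s−s₁)}`
  calc U s ρ ≤ Φ s ρ := hlim
    _ = A₀ * c * Real.exp (-lam * (s - s₁)) * K ρ := rfl
    _ ≤ A₀ * c * Real.exp (-lam * (s - s₁)) * (A₁ * (1 + ρ) ^ 3) :=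
        mul_le_mul_of_nonneg_left (hup ρ hρ) (by positivity)
    _ = A₀ * A₁ * c * (1 + ρ) ^ 3 * Real.exp (-lam * (s - s₁)) := by ring

end HalfLineOU

end Literature.Analysis.FluidPDE

end
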